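import Literature.NumberTheory.Automorphic.CDTModularityProofs
import HarnessLib

/-!
# `existsUnique_isNewformOf` assembled from the tree's modularity trust base

The named fact `Literature.NumberTheory.EllipticCurves.ModularForms.existsUnique_isNewformOf`
(`CuspFormLFunction.lean`) says: for every elliptic curve `E / ℚ` of conductor `N_E` there is a
unique newform `f ∈ S₂(Γ₀(N_E))` with `aₙ(f) = aₙ(E)` for all `n` — the Modularity Theorem
(Wiles 1995, Thm. 0.4, for semistable `E`, with Taylor–Wiles 1995; Breuil–Conrad–Diamond–Taylor
2001, Thm. A = Thm. 2.2.2, for every `E / ℚ`) with level `=` conductor (Carayol 1986), in the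
form printed as Diamond–Shurman 2005, Thm. 8.8.1 ("Version `a_p`": `a_p(f) = a_p(E)` for all
primes `p`, some newform `f ∈ S₂(Γ₀(N_E))`) and Thm. 8.8.3 ("Version `L`": `L(s, f) = L(s, E)`),
plus uniqueness of `f`.

This sibling file records, as sorry-free theorems and without any new definition or named fact,
exactly how far the tree proves it:

* uniqueness is elementary and proved (`IsNewformOf.unique`, the `q`-expansion principle), so the
  fact is equivalent to its existence half `exists_isNewformOf`
  (`existsUnique_isNewformOf_iff`, both in `CuspFormLFunction.lean`);
* existence is BCDT Thm. A, proved in `Literature.NumberTheory.Automorphic.BCDTModularity`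
  (Part 3, `BCDT.exists_isNewformOf_of_theoremB_of_CDT`: Thm. 2.2.2 from Thm. 2.2.1 = Theorem B
  and Conrad–Diamond–Taylor 1999, Thm. 7.2.4, the determinant input `det ρ̄_{E,5} = χ̄₅` being
  proved from the Weil pairing) and refined in
  `Literature.NumberTheory.Automorphic.CDTModularityProofs`
  (`BCDT.exists_isNewformOf_of_theoremB_of_CDT712_722`: CDT Thm. 7.2.4 from Thms. 7.1.2, 7.2.2
  and Ogg–Saito for `V₅ E` at `3`).

Hence the two assemblies below. After them the trust base of `existsUnique_isNewformOf` in the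
tree is `{BCDT.theoremB, BCDT.CDT_theorem_7_2_4}`, or, one level down,
`{BCDT.theoremB` (BCDT Thm. 2.2.1: `R = T` at `3`, Langlands–Tunnell)`, BCDT.CDT_theorem_7_1_2`
(CDT 1999, Thm. 7.1.2: every `E / ℚ` with `27 ∤ N_E` is modular)`, BCDT.CDT_theorem_7_2_2`
(CDT 1999, Thm. 7.2.2)`, WeierstrassCurve.artinConductorExponent_tate_eq_conductorExponent_of_isElliptic · 5`
(Ogg–Saito: the Artin conductor exponent of `V₅ E` at `p ≠ 5` is the conductor exponent `f_p`)`}`.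
None of these leaves is within reach of Mathlib at the pinned version (no deformation rings,
Hecke algebras `T_𝔪`, Néron models or modularity lifting), so `existsUnique_isNewformOf_holds`
is not provided; users holding `(hmod : existsUnique_isNewformOf)` can be fed
`existsUnique_isNewformOf_of_theoremB_of_CDT hB hCDT`.

What is NOT here: Wiles 1995, Thm. 0.4 itself (the semistable case) is not vendored as a
separate named fact — it is the special case of `exists_isNewformOf` for semistable `E` and no
statement in the tree consumes it in that form.

## References

* A. Wiles, *Modular elliptic curves and Fermat's Last Theorem*, Ann. of Math. 141 (1995),
  443–551, Thm. 0.4; R. Taylor, A. Wiles, *Ring-theoretic properties of certain Hecke algebras*,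
  ibid. 553–572.
* C. Breuil, B. Conrad, F. Diamond, R. Taylor, *On the modularity of elliptic curves over `ℚ`:
  wild `3`-adic exercises*, J. Amer. Math. Soc. 14 (2001), 843–939, Thm. A, Thms. 2.2.1–2.2.2.
* B. Conrad, F. Diamond, R. Taylor, *Modularity of certain potentially Barsotti–Tate Galois
  representations*, J. Amer. Math. Soc. 12 (1999), 521–567, Thms. 7.1.2, 7.2.2, 7.2.4.
* F. Diamond, J. Shurman, *A First Course in Modular Forms*, GTM 228, 2005, Thms. 8.8.1, 8.8.3.
-/

open scoped MatrixGroups ModularForm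

open CongruenceSubgroup

namespace Literature.NumberTheory.EllipticCurves.ModularForms

open Automorphic.BCDT

/-- **Modularity with level `=` conductor, `∃!` form** (`existsUnique_isNewformOf`: Wiles 1995,
Thm. 0.4, for semistable `E`; Breuil–Conrad–Diamond–Taylor 2001, Thm. A, in general;
Diamond–Shurman Thms. 8.8.1/8.8.3) **from BCDT Theorem B and CDT Theorem 7.2.4**: existence is
`BCDT.exists_isNewformOf_of_theoremB_of_CDT` (BCDT §2.2: Thm. 2.2.2 from Thm. 2.2.1 and CDT
Thm. 7.2.4), uniqueness is the `q`-expansion principle (`existsUnique_isNewformOf_of_exists`).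
[cite: BCDTJAMS2001, Theorem A] -/
theorem existsUnique_isNewformOf_of_theoremB_of_CDT (hB : theoremB) (hCDT : CDT_theorem_7_2_4) :
    existsUnique_isNewformOf :=
  existsUnique_isNewformOf_of_exists (exists_isNewformOf_of_theoremB_of_CDT hB hCDT)

/-- **Modularity with level `=` conductor, `∃!` form, from the four leaves of the tree's
decomposition**: BCDT Theorem B (`theoremB`), Conrad–Diamond–Taylor 1999 Thms. 7.1.2 and 7.2.2
(`CDT_theorem_7_1_2`, `CDT_theorem_7_2_2`) and Ogg–Saito for `V₅ E` (`hOgg`), via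
`BCDT.exists_isNewformOf_of_theoremB_of_CDT712_722` and the `q`-expansion principle.
[cite: BCDTJAMS2001, Theorem A] -/
theorem existsUnique_isNewformOf_of_theoremB_of_CDT712_722 (hB : theoremB)
    (h712 : CDT_theorem_7_1_2) (h722 : CDT_theorem_7_2_2)
    (hOgg : ∀ W : WeierstrassCurve ℚ,
      W.artinConductorExponent_tate_eq_conductorExponent_of_isElliptic 5) :
    existsUnique_isNewformOf :=
  existsUnique_isNewformOf_of_exists (exists_isNewformOf_of_theoremB_of_CDT712_722 hB h712 h722 hOgg)

/-- **Per-curve form**: if `E` is modular in the sense of BCDT (`BCDT.IsModular W`: some newform of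
level `N_E` has `aₙ(f) = aₙ(E)`), then that newform is unique. [folklore] -/
theorem existsUnique_isNewformOf_of_isModular (W : WeierstrassCurve ℚ) [NeZero (W.conductorNorm ℤ)]
    (h : IsModular W) : ∃! f : CuspForm (Gamma0 (W.conductorNorm ℤ)) 2, IsNewformOf W f := by
  obtain ⟨f, hf⟩ := h
  exact ⟨f, hf, fun g hg ↦ hg.unique hf⟩

/-- **Per-curve modularity from Theorem B and CDT Thm. 7.2.4** (BCDT Thm. 2.2.2 for the given
`E`, `BCDT.isModular_of_theoremB_of_CDT`), in the `∃!` form of `existsUnique_isNewformOf`.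
[cite: BCDTJAMS2001, Theorem 2.2.2] -/
theorem existsUnique_isNewformOf_apply_of_theoremB_of_CDT (hB : theoremB)
    (hCDT : CDT_theorem_7_2_4) (W : WeierstrassCurve ℚ) [W.IsElliptic]
    [NeZero (W.conductorNorm ℤ)] :
    ∃! f : CuspForm (Gamma0 (W.conductorNorm ℤ)) 2, IsNewformOf W f :=
  existsUnique_isNewformOf_of_isModular W (isModular_of_theoremB_of_CDT hB hCDT W)

end Literature.NumberTheory.EllipticCurves.ModularForms
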